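import Summits.BirchSwinnertonDyer.BirchSwinnertonDyer.Theorems.Rank1ResidualJetThm63LocalFactsV3
import Summits.BirchSwinnertonDyer.BirchSwinnertonDyer.Theorems.Rank1ResidualJetCarrierAddEndForm
import Summits.BirchSwinnertonDyer.BirchSwinnertonDyer.Theorems.Rank1ResidualJetCarrierNeEndForm
import Summits.BirchSwinnertonDyer.BirchSwinnertonDyer.Theorems.Rank1ResidualJetRingClassFields
import Summits.BirchSwinnertonDyer.BirchSwinnertonDyer.Theorems.Rank1ResidualJetKodairaNeronCyclic
import HarnessLib

/-!
# T1 JET (cell `bsd-jet`), road K — END FORMS «named print» for the reading binders K1 (carrier a prime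
# `q ∣ N`, `q ≠ p`) and K4 (additive carrier `p ∣ N`): ⟸ {h52, hCV, h44, hPT, hGZ} + ONE gap

HONEST FRAMING (programme file §HONESTY, verbatim): «no tranche here proves BSD; ARM L moves the
LITERAL column of an r ≤ 1 census into the kernel-proved-modulo-named-print column.» THEOREMS ONLY
(seat `bsd-jet-pv-2`, session g5; `--supports stmt-BirchSwinnertonDyer-14418`, helper); 0 classes
move; road-K DOCUMENTARY end forms. WHAT THIS IS. The twins of
`jetchevDivisibilityCarrierMult_of_namedPrint` (`Rank1ResidualJetCarrierMultEndFormNamedPrint`) for K1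
and K4: the END FORMS `jetchevDivisibilityCarrierNe_of_localFacts` (p517404) and
`jetchevDivisibilityCarrierAdd_of_localFacts` (p517696) re-stated over the H63 line «v3»
(`tamagawaExponent_le_mInfty_of_localFactsPrime_v3`) with EXACTLY the named print {`h52`, `hCV`, `h44`,
`hPT`, `hGZ` (x11b3 receptacle form of [GZ86 III (3.1)], closed WITH the print's guards: `d_K ∉ {−3,−4}`,
Heegner hypothesis, `p` odd with `ρ̄` onto, square-free Kolyvagin conductors, `n′ ⊥ p`)} and ONE kernel
gap `h49str` (Jetchev's Prop. 4.9 proper at the carrier pair, closed with the frame's guards — pv-1 g7's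
line). DISCHARGED BY NAME and no longer inputs: `hRCF` (`numberField_ringClassField`, via the primed
bridge), `h53` (struck: `JET.sign_conjAct_kolyvaginClass`), the CM facts (`…_holds`), `hloc` (pv-1
p522585 from `hPT`), `h𝒯σ` (p523159), `h𝒯sd` (typer p525648, in frame under the unit guard), `hΦ`
(`kodairaNeron_isAddCyclic_forall`, p520826), `htr`/`h49tr` (p528943). References:
[cite: Jetchev2008, Thm. 1.4, Thm. 5.2, Prop. 4.9, Prop. 5.3] [cite: McCallumLMS1991, Prop. 4.4, Prop. 5.2]
[cite: GrossLMS1991, §3 (3.1), Prop. 5.4] [cite: GrossZagier1986, III (3.1)]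
[cite: MilneADT2006, Ch. I, Thm. 4.10(b)].
-/

set_option autoImplicit false

noncomputable section

open scoped Classical Pointwise

open WeierstrassCurve IsDedekindDomain NumberField Field Literature.NumberTheory.EllipticCurves
  Literature.NumberTheory.EllipticCurves.ModularForms Literature.NumberTheory.EllipticCurves.Jetchev2008
  Literature.NumberTheory.GaloisRepresentations Literature.NumberTheory.GaloisCohomology
  Literature.NumberTheory.GaloisRepresentations.DiscreteGaloisModule
  Summit.BirchSwinnertonDyer.Rank1Residual.X11b Summit.BirchSwinnertonDyer.Rank1Residual.X11b.Three
  Summit.BirchSwinnertonDyer.Rank1Residual.JET.SelmerVocabulary Literature.NumberTheory.Automorphic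

namespace Summit.BirchSwinnertonDyer.Rank1Residual.JET

/-- **K1 ⟸ named print {h52, hCV, h44, hPT, hGZ (scoped, guarded)} + ONE kernel gap (`h49str`,
guarded)** — carrier a prime `q ∣ N`, `q ≠ p`, `t = ord_p c_q(E/ℚ_q)`; over the H63 line «v3».
[cite: Jetchev2008, Thm. 1.4, Thm. 5.2, Prop. 4.9, Prop. 5.3] [cite: McCallumLMS1991, Prop. 5.2]
[cite: GrossZagier1986, III (3.1)] -/
theorem jetchevDivisibilityCarrierNe_of_namedPrint
    -- NAMED PRINT
    (h52 : McCallum1991.prop52_exists_conductor_kolyvaginClass_order_eq)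
    (hCV : JetchevCoreVertexExistence)
    (h44 : McCallum1991.prop44_localOrder_kolyvaginClass_mul_eq)
    (hPT : ∀ (K : Type) [Field K] [NumberField K], poitouTate_selmerStructure_duality_conj K)
    (hGZ : ∀ (W : WeierstrassCurve ℚ) [W.IsElliptic] [W.IsGloballyMinimal] [NeZero (W.conductorNorm ℤ)]
      (K : Type) [Field K] [NumberField K], IsImaginaryQuadratic K →
      NumberField.discr K ≠ -3 → NumberField.discr K ≠ -4 →
      SatisfiesHeegnerHypothesis (W.conductorNorm ℤ) K →
      ∀ (p : ℕ) [Fact p.Prime], p ≠ 2 → W.HasSurjectiveModNGaloisRep p →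
      ∀ (Dt : ModularParametrizationData W (W.conductorNorm ℤ)) (β : ℤ) (ι : K →+* ℂ)
      [∀ j : ℕ, NumberField (ringClassField K ι j)],
      ∃ n' : ℤ, IsCoprime (p : ℤ) n' ∧ ∀ (m : ℕ), Squarefree m →
        (∀ q ∈ m.primeFactors, Zhang2014.IsKolyvaginPrime (W.conductorNorm ℤ) W K p q) →
        ∀ (dm : KolyvaginHeegnerData Dt β ι m)
        (γ : ringClassField K ι m ≃ₐ[ℚ] ringClassField K ι m), γ ∈ ringClassGal ι m →
        ∀ v : HeightOneSpectrum (𝓞 K), ¬ (W.baseChange K).HasGoodReductionAt v →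
          n' • pointsMap (W.baseChange K) (v.adicCompletion K)
              (dm.toGeomPoints (pointGalHom W (ringClassField K ι m) γ dm.y)) ∈
            E0Receptacle (W.baseChange K) v ∧
          ∀ (ℓ : ℕ), ℓ ∈ m.primeFactors → ∀ (dm' : KolyvaginHeegnerData Dt β ι (m / ℓ))
            (hle : ringClassField K ι (m / ℓ) ≤ ringClassField K ι m),
            n' • pointsMap (W.baseChange K) (v.adicCompletion K)
                (dm.toGeomPoints (pointGalHom W (ringClassField K ι m) γ
                  (WeierstrassCurve.Affine.Point.map (W' := W)
                    ((RingClassField.inclusion ι hle).restrictScalars ℚ) dm'.y))) ∈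
              E0Receptacle (W.baseChange K) v)
    -- THE ONE REMAINING KERNEL GAP (pv-1 g7's line): Jetchev's Prop. 4.9 proper at the carrier pair,
    -- closed WITH the frame's guards (feed pv-1's carrier theorem here when it lands)
    (h49str : ∀ (W : WeierstrassCurve ℚ) [W.IsElliptic] [W.IsGloballyMinimal] [NeZero (W.conductorNorm ℤ)]
      (K : Type) [Field K] [NumberField K], IsImaginaryQuadratic K →
      NumberField.discr K ≠ -3 → NumberField.discr K ≠ -4 →
      SatisfiesHeegnerHypothesis (W.conductorNorm ℤ) K →
      ∀ (p : ℕ) [Fact p.Prime], p ≠ 2 → (∀ n : ℕ, W.HasSurjectiveModNGaloisRep (p ^ n : ℕ)) →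
      ∀ (Dt : ModularParametrizationData W (W.conductorNorm ℤ)) (β : ℤ) (ι : K →+* ℂ)
        [∀ j : ℕ, NumberField (ringClassField K ι j)] (n' : ℤ), IsCoprime (p : ℤ) n' →
      (∀ (m : ℕ), Squarefree m →
        (∀ q ∈ m.primeFactors, Zhang2014.IsKolyvaginPrime (W.conductorNorm ℤ) W K p q) →
        ∀ (dm : KolyvaginHeegnerData Dt β ι m)
        (γ : ringClassField K ι m ≃ₐ[ℚ] ringClassField K ι m), γ ∈ ringClassGal ι m →
        ∀ v : HeightOneSpectrum (𝓞 K), ¬ (W.baseChange K).HasGoodReductionAt v →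
          n' • pointsMap (W.baseChange K) (v.adicCompletion K)
              (dm.toGeomPoints (pointGalHom W (ringClassField K ι m) γ dm.y)) ∈
            E0Receptacle (W.baseChange K) v ∧
          ∀ (ℓ : ℕ), ℓ ∈ m.primeFactors → ∀ (dm' : KolyvaginHeegnerData Dt β ι (m / ℓ))
            (hle : ringClassField K ι (m / ℓ) ≤ ringClassField K ι m),
            n' • pointsMap (W.baseChange K) (v.adicCompletion K)
                (dm.toGeomPoints (pointGalHom W (ringClassField K ι m) γ
                  (WeierstrassCurve.Affine.Point.map (W' := W)
                    ((RingClassField.inclusion ι hle).restrictScalars ℚ) dm'.y))) ∈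
              E0Receptacle (W.baseChange K) v) →
      ∀ (k : ℕ), 1 ≤ k → ∀ (hn : ((p ^ k : ℕ) : ℤ) ≠ 0) (c : ℕ), Squarefree c →
        (∀ ℓ ∈ c.primeFactors, Zhang2014.IsKolyvaginPrime (W.conductorNorm ℤ) W K p ℓ ∧
          k ≤ Zhang2014.kolyvaginIndex W p ℓ) →
      ∀ (τ : K ≃ₐ[ℚ] K), τ ≠ 1 → ∀ (v₀ : HeightOneSpectrum (𝓞 K)), τ • v₀ ≠ v₀ →
        ((W.conductorNorm ℤ : ℕ) : 𝓞 K) ∈ v₀.asIdeal →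
      ∀ (ℓ : ℕ), Zhang2014.IsKolyvaginPrime (W.conductorNorm ℤ) W K p ℓ →
        k ≤ Zhang2014.kolyvaginIndex W p ℓ → ℓ ∉ c.primeFactors →
      ∀ (d' : KolyvaginHeegnerData Dt β ι (c * ℓ)), ∀ q ∈ ({v₀, τ • v₀} : Finset _),
        galoisCohomology.localization ((W.baseChange K).torsionGaloisModule ((p ^ k : ℕ) : ℤ))
            (Sum.inr q) 1 (d'.kolyvaginClass (Fact.out : p.Prime) k) ∈ stringentFamily W K hn (Sum.inr q)) :
    JetchevDivisibilityCarrierNe := by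
  refine jetchevDivisibilityCarrierNe_of_prop52_of_coreVertexExistence' h52 hCV ?_
  intro W _ _ _ hcm K _ _ hK hD3 hD4 hH τ hτ p _ hp2 htower Dt β ι _ d₁ _ q _ hqN _ mdiv m hmdiv hm mInf
    _ _ k c hk hcore hmc hkM htk hik
  have hp : p.Prime := Fact.out
  -- trivial case: `p ∤ c_p`
  by_cases ht0 : padicValNat p ((W.baseChange ℚ_[q]).localTamagawaNumber ℤ_[q]) = 0
  · rw [ht0]; exact Nat.zero_le _
  have hdvd : p ∣ (W.baseChange ℚ_[q]).localTamagawaNumber ℤ_[q] :=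
    dvd_of_one_le_padicValNat (Nat.one_le_iff_ne_zero.mpr ht0)
  -- the carrier place `v₀ ∣ q`, split, and the transport of the row data
  obtain ⟨v₀, hv₀, hv₀N, hqv₀⟩ := exists_split_place_of_dvd K hK τ hτ hH q hqN
  obtain ⟨hminK, hminP, hcEq, hc0, hcyc⟩ := carrierRowData_of_split W K q hK τ v₀ hv₀ hqv₀
  haveI := hminK
  haveI := hminP
  haveI := hcyc (kodairaNeron_isAddCyclic_forall W q p hp2 hdvd)
  -- `τ² = 1`
  haveI : Algebra.IsQuadraticExtension ℚ K := ⟨hK.1⟩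
  have hτ2 : τ * τ = 1 := by
    have hcard : Nat.card (K ≃ₐ[ℚ] K) = 2 := by rw [IsGalois.card_aut_eq_finrank, hK.1]
    obtain ⟨y, -, hyu⟩ := (Nat.card_eq_two_iff' (1 : K ≃ₐ[ℚ] K)).mp hcard
    have h1 : τ = y := hyu τ hτ
    have h2 : τ⁻¹ = y := hyu τ⁻¹ (inv_ne_one.mpr hτ)
    rw [mul_eq_one_iff_eq_inv]
    exact h1.trans h2.symm
  -- instances at level `p^k`
  haveI : NeZero (p ^ k) := ⟨pow_ne_zero k hp.ne_zero⟩
  haveI : Finite (geomTorsion (W.baseChange K) ((p ^ k : ℕ) : ℤ)) :=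
    finite_geomTorsion_of_neZero (W.baseChange K) (p ^ k)
  have hn : ((p ^ k : ℕ) : ℤ) ≠ 0 := by exact_mod_cast pow_ne_zero k hp.ne_zero
  -- the named-print schema [GZ86 III (3.1)] at this frame
  have hρ : W.HasSurjectiveModNGaloisRep p := by simpa using htower 1
  obtain ⟨n', hcop', hGZ'⟩ := hGZ W K hK hD3 hD4 hH p hp2 hρ Dt β ι
  -- Kolyvagin data of the core vertex
  have hkc : (k : ℕ∞) ≤ Zhang2014.levelIndex W p c.1 := le_trans le_self_add hkM
  have hcK : ∀ ℓ ∈ c.1.primeFactors, Zhang2014.IsKolyvaginPrime (W.conductorNorm ℤ) W K p ℓ ∧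
      k ≤ Zhang2014.kolyvaginIndex W p ℓ := fun ℓ hℓ ↦
    ⟨c.2.2 ℓ hℓ, Zhang2014.natCast_le_levelIndex_iff.mp hkc ℓ hℓ⟩
  -- the exponent
  have hfac : (((W.baseChange K).baseChange (v₀.adicCompletion K)).localTamagawaNumber
      (v₀.adicCompletionIntegers K)).factorization p =
      padicValNat p ((W.baseChange ℚ_[q]).localTamagawaNumber ℤ_[q]) := by
    rw [hcEq, Nat.factorization_def _ hp]
  have htk' : (((W.baseChange K).baseChange (v₀.adicCompletion K)).localTamagawaNumber
      (v₀.adicCompletionIntegers K)).factorization p < k := by rw [hfac]; exact htk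
  have key := tamagawaExponent_le_mInfty_of_localFactsPrime_v3 h44 W hcm K hK hD3 hD4 hH (hPT K) p hp2
    htower Dt β ι τ hτ hτ2 hcop' hGZ' mdiv m hmdiv hm k hn c hk hcore mInf hmc hkM hik v₀ hv₀ hv₀N hc0 htk'
    (fun ℓ h1 h2 h3 d' q hq ↦ h49str W K hK hD3 hD4 hH p hp2 htower Dt β ι n' hcop' hGZ' k hk hn c.1 c.2.1
      hcK τ hτ v₀ hv₀ hv₀N ℓ h1 h2 h3 d' q hq)
  rw [hfac] at key
  exact key

/-- **K4 ⟸ named print {h52, hCV, h44, hPT, hGZ (scoped, guarded)} + ONE kernel gap (`h49str`,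
guarded)** — additive carrier `p ∣ N`; over the H63 line «v3». [cite: Jetchev2008, Thm. 1.4, Thm. 5.2,
Prop. 4.9, Prop. 5.3] [cite: McCallumLMS1991, Prop. 5.2] [cite: GrossZagier1986, III (3.1)] -/
theorem jetchevDivisibilityCarrierAdd_of_namedPrint
    -- NAMED PRINT
    (h52 : McCallum1991.prop52_exists_conductor_kolyvaginClass_order_eq)
    (hCV : JetchevCoreVertexExistence)
    (h44 : McCallum1991.prop44_localOrder_kolyvaginClass_mul_eq)
    (hPT : ∀ (K : Type) [Field K] [NumberField K], poitouTate_selmerStructure_duality_conj K)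
    (hGZ : ∀ (W : WeierstrassCurve ℚ) [W.IsElliptic] [W.IsGloballyMinimal] [NeZero (W.conductorNorm ℤ)]
      (K : Type) [Field K] [NumberField K], IsImaginaryQuadratic K →
      NumberField.discr K ≠ -3 → NumberField.discr K ≠ -4 →
      SatisfiesHeegnerHypothesis (W.conductorNorm ℤ) K →
      ∀ (p : ℕ) [Fact p.Prime], p ≠ 2 → W.HasSurjectiveModNGaloisRep p →
      ∀ (Dt : ModularParametrizationData W (W.conductorNorm ℤ)) (β : ℤ) (ι : K →+* ℂ)
      [∀ j : ℕ, NumberField (ringClassField K ι j)],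
      ∃ n' : ℤ, IsCoprime (p : ℤ) n' ∧ ∀ (m : ℕ), Squarefree m →
        (∀ q ∈ m.primeFactors, Zhang2014.IsKolyvaginPrime (W.conductorNorm ℤ) W K p q) →
        ∀ (dm : KolyvaginHeegnerData Dt β ι m)
        (γ : ringClassField K ι m ≃ₐ[ℚ] ringClassField K ι m), γ ∈ ringClassGal ι m →
        ∀ v : HeightOneSpectrum (𝓞 K), ¬ (W.baseChange K).HasGoodReductionAt v →
          n' • pointsMap (W.baseChange K) (v.adicCompletion K)
              (dm.toGeomPoints (pointGalHom W (ringClassField K ι m) γ dm.y)) ∈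
            E0Receptacle (W.baseChange K) v ∧
          ∀ (ℓ : ℕ), ℓ ∈ m.primeFactors → ∀ (dm' : KolyvaginHeegnerData Dt β ι (m / ℓ))
            (hle : ringClassField K ι (m / ℓ) ≤ ringClassField K ι m),
            n' • pointsMap (W.baseChange K) (v.adicCompletion K)
                (dm.toGeomPoints (pointGalHom W (ringClassField K ι m) γ
                  (WeierstrassCurve.Affine.Point.map (W' := W)
                    ((RingClassField.inclusion ι hle).restrictScalars ℚ) dm'.y))) ∈
              E0Receptacle (W.baseChange K) v)
    -- THE ONE REMAINING KERNEL GAP (pv-1 g7's line): Jetchev's Prop. 4.9 proper at the carrier pair,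
    -- closed WITH the frame's guards (feed pv-1's carrier theorem here when it lands)
    (h49str : ∀ (W : WeierstrassCurve ℚ) [W.IsElliptic] [W.IsGloballyMinimal] [NeZero (W.conductorNorm ℤ)]
      (K : Type) [Field K] [NumberField K], IsImaginaryQuadratic K →
      NumberField.discr K ≠ -3 → NumberField.discr K ≠ -4 →
      SatisfiesHeegnerHypothesis (W.conductorNorm ℤ) K →
      ∀ (p : ℕ) [Fact p.Prime], p ≠ 2 → (∀ n : ℕ, W.HasSurjectiveModNGaloisRep (p ^ n : ℕ)) →
      ∀ (Dt : ModularParametrizationData W (W.conductorNorm ℤ)) (β : ℤ) (ι : K →+* ℂ)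
        [∀ j : ℕ, NumberField (ringClassField K ι j)] (n' : ℤ), IsCoprime (p : ℤ) n' →
      (∀ (m : ℕ), Squarefree m →
        (∀ q ∈ m.primeFactors, Zhang2014.IsKolyvaginPrime (W.conductorNorm ℤ) W K p q) →
        ∀ (dm : KolyvaginHeegnerData Dt β ι m)
        (γ : ringClassField K ι m ≃ₐ[ℚ] ringClassField K ι m), γ ∈ ringClassGal ι m →
        ∀ v : HeightOneSpectrum (𝓞 K), ¬ (W.baseChange K).HasGoodReductionAt v →
          n' • pointsMap (W.baseChange K) (v.adicCompletion K)
              (dm.toGeomPoints (pointGalHom W (ringClassField K ι m) γ dm.y)) ∈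
            E0Receptacle (W.baseChange K) v ∧
          ∀ (ℓ : ℕ), ℓ ∈ m.primeFactors → ∀ (dm' : KolyvaginHeegnerData Dt β ι (m / ℓ))
            (hle : ringClassField K ι (m / ℓ) ≤ ringClassField K ι m),
            n' • pointsMap (W.baseChange K) (v.adicCompletion K)
                (dm.toGeomPoints (pointGalHom W (ringClassField K ι m) γ
                  (WeierstrassCurve.Affine.Point.map (W' := W)
                    ((RingClassField.inclusion ι hle).restrictScalars ℚ) dm'.y))) ∈
              E0Receptacle (W.baseChange K) v) →
      ∀ (k : ℕ), 1 ≤ k → ∀ (hn : ((p ^ k : ℕ) : ℤ) ≠ 0) (c : ℕ), Squarefree c →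
        (∀ ℓ ∈ c.primeFactors, Zhang2014.IsKolyvaginPrime (W.conductorNorm ℤ) W K p ℓ ∧
          k ≤ Zhang2014.kolyvaginIndex W p ℓ) →
      ∀ (τ : K ≃ₐ[ℚ] K), τ ≠ 1 → ∀ (v₀ : HeightOneSpectrum (𝓞 K)), τ • v₀ ≠ v₀ →
        ((W.conductorNorm ℤ : ℕ) : 𝓞 K) ∈ v₀.asIdeal →
      ∀ (ℓ : ℕ), Zhang2014.IsKolyvaginPrime (W.conductorNorm ℤ) W K p ℓ →
        k ≤ Zhang2014.kolyvaginIndex W p ℓ → ℓ ∉ c.primeFactors →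
      ∀ (d' : KolyvaginHeegnerData Dt β ι (c * ℓ)), ∀ q ∈ ({v₀, τ • v₀} : Finset _),
        galoisCohomology.localization ((W.baseChange K).torsionGaloisModule ((p ^ k : ℕ) : ℤ))
            (Sum.inr q) 1 (d'.kolyvaginClass (Fact.out : p.Prime) k) ∈ stringentFamily W K hn (Sum.inr q)) :
    JetchevDivisibilityCarrierAdd := by
  refine jetchevDivisibilityCarrierAdd_of_prop52_of_coreVertexExistence' h52 hCV ?_
  intro W _ _ _ hcm K _ _ hK hD3 hD4 hH τ hτ p _ hp2 hngood _ htower Dt β ι _ d₁ _ mdiv m hmdiv hm mInf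
    _ _ k c hk hcore hmc hkM htk hik
  have hp : p.Prime := Fact.out
  -- trivial case: `p ∤ c_p`
  by_cases ht0 : padicValNat p ((W.baseChange ℚ_[p]).localTamagawaNumber ℤ_[p]) = 0
  · rw [ht0]; exact Nat.zero_le _
  have hdvd : p ∣ (W.baseChange ℚ_[p]).localTamagawaNumber ℤ_[p] :=
    dvd_of_one_le_padicValNat (Nat.one_le_iff_ne_zero.mpr ht0)
  -- the carrier place `v₀ ∣ p` (`p ∣ N`: bad reduction), split, and the transport of the row data
  have hpN : p ∣ W.conductorNorm ℤ := (W.dvd_conductorNorm_iff_not_hasGoodReductionAtPrime p).mpr hngood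
  obtain ⟨v₀, hv₀, hv₀N, hpv₀⟩ := exists_split_place_of_dvd K hK τ hτ hH p hpN
  obtain ⟨hminK, hminP, hcEq, hc0, hcyc⟩ := carrierRowData_of_split W K p hK τ v₀ hv₀ hpv₀
  haveI := hminK
  haveI := hminP
  haveI := hcyc (kodairaNeron_isAddCyclic_forall W p p hp2 hdvd)
  -- `τ² = 1`
  haveI : Algebra.IsQuadraticExtension ℚ K := ⟨hK.1⟩
  have hτ2 : τ * τ = 1 := by
    have hcard : Nat.card (K ≃ₐ[ℚ] K) = 2 := by rw [IsGalois.card_aut_eq_finrank, hK.1]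
    obtain ⟨y, -, hyu⟩ := (Nat.card_eq_two_iff' (1 : K ≃ₐ[ℚ] K)).mp hcard
    have h1 : τ = y := hyu τ hτ
    have h2 : τ⁻¹ = y := hyu τ⁻¹ (inv_ne_one.mpr hτ)
    rw [mul_eq_one_iff_eq_inv]
    exact h1.trans h2.symm
  -- instances at level `p^k`
  haveI : NeZero (p ^ k) := ⟨pow_ne_zero k hp.ne_zero⟩
  haveI : Finite (geomTorsion (W.baseChange K) ((p ^ k : ℕ) : ℤ)) :=
    finite_geomTorsion_of_neZero (W.baseChange K) (p ^ k)
  have hn : ((p ^ k : ℕ) : ℤ) ≠ 0 := by exact_mod_cast pow_ne_zero k hp.ne_zero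
  -- the named-print schema [GZ86 III (3.1)] at this frame
  have hρ : W.HasSurjectiveModNGaloisRep p := by simpa using htower 1
  obtain ⟨n', hcop', hGZ'⟩ := hGZ W K hK hD3 hD4 hH p hp2 hρ Dt β ι
  -- Kolyvagin data of the core vertex
  have hkc : (k : ℕ∞) ≤ Zhang2014.levelIndex W p c.1 := le_trans le_self_add hkM
  have hcK : ∀ ℓ ∈ c.1.primeFactors, Zhang2014.IsKolyvaginPrime (W.conductorNorm ℤ) W K p ℓ ∧
      k ≤ Zhang2014.kolyvaginIndex W p ℓ := fun ℓ hℓ ↦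
    ⟨c.2.2 ℓ hℓ, Zhang2014.natCast_le_levelIndex_iff.mp hkc ℓ hℓ⟩
  -- the exponent
  have hfac : (((W.baseChange K).baseChange (v₀.adicCompletion K)).localTamagawaNumber
      (v₀.adicCompletionIntegers K)).factorization p =
      padicValNat p ((W.baseChange ℚ_[p]).localTamagawaNumber ℤ_[p]) := by
    rw [hcEq, Nat.factorization_def _ hp]
  have htk' : (((W.baseChange K).baseChange (v₀.adicCompletion K)).localTamagawaNumber
      (v₀.adicCompletionIntegers K)).factorization p < k := by rw [hfac]; exact htk
  have key := tamagawaExponent_le_mInfty_of_localFactsPrime_v3 h44 W hcm K hK hD3 hD4 hH (hPT K) p hp2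
    htower Dt β ι τ hτ hτ2 hcop' hGZ' mdiv m hmdiv hm k hn c hk hcore mInf hmc hkM hik v₀ hv₀ hv₀N hc0 htk'
    (fun ℓ h1 h2 h3 d' q hq ↦ h49str W K hK hD3 hD4 hH p hp2 htower Dt β ι n' hcop' hGZ' k hk hn c.1 c.2.1
      hcK τ hτ v₀ hv₀ hv₀N ℓ h1 h2 h3 d' q hq)
  rw [hfac] at key
  exact key

end Summit.BirchSwinnertonDyer.Rank1Residual.JET

end
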